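import Literature.Analysis.Complex.ExpTypeIndicator
import HarnessLib

/-!
# The indicator inequality for entire functions of anisotropic exponential type

Topic `Literature/Analysis/Complex`. Everything in this file is PROVED (no named facts). It is the
anisotropic refinement of the tree's `Literature.Analysis.Complex.eq_zero_of_norm_le_exp_of_decay`
(the indicator inequality `h(0) + h(π) ≥ 0` of the theory of the Phragmén–Lindelöf indicator,
Boas, *Entire Functions*, §5.4, in the form used for Voronin-type denseness theorems, Steuding,
*Value-Distribution of L-Functions*, Lemma 5.8):

* `norm_le_exp_neg_of_decay_aniso` — an entire `ρ` with the ANISOTROPIC bound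
  `‖ρ(z)‖ ≤ C e^{R‖z‖ + T|Im z|}` (`R, T ≥ 0`) and `‖ρ(x)‖ ≤ C' e^{-ax}` for `x ≥ 0` with `a > R`
  decays faster than every exponential along the imaginary axis;
* `eq_zero_of_norm_le_exp_of_decay_aniso` — such a `ρ` vanishes identically: only the type `R`
  governing the growth along the REAL axis has to be beaten by the decay rate `a`; the extra growth
  `e^{T|Im z|}` in the imaginary direction is harmless.

This is what is needed for Bagchi's positive-density argument on TALL domains (rectangles of
any height in the critical strip): the pairing entire functions `z ↦ ∫ e^{-sz} dμ(s)` with `μ`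
supported in `[σ₁, σ₂] × [t₁, t₂]` have type `(σ₂ − σ₁)/2` in the real direction but
`(t₂ − t₁)/2` in the imaginary direction (Steuding's Lemma 5.8 is stated for measures with
support in a half-plane `σ > σ₀`; the tree's isotropic form covers supports in discs only).

Proofs: those of the isotropic statements verbatim, the small angle `θ₀` of the sector
`0 ≤ arg z ≤ π − θ₀` being chosen for `V + T` in place of `V` (on the ray `arg z = π − θ₀` the
anisotropic bound reads `e^{r(R + T sin θ₀)}`).

## References

* [Boas1954] R. P. Boas, *Entire Functions*, Academic Press 1954, §5.4 (properties of the
  indicator: `h(θ) + h(θ+π) ≥ 0`).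
* [Steuding2007] J. Steuding, *Value-Distribution of L-Functions*, LNM 1877, Springer 2007, §5.3,
  Lemma 5.8.
-/

noncomputable section

open Complex Filter Topology Set Metric Asymptotics Bornology

namespace Literature.Analysis.Complex

/-- An anisotropic bound `‖ρ(z)‖ ≤ C e^{R‖z‖ + T|Im z|}` (`T ≥ 0`) gives the isotropic bound
`‖ρ(z)‖ ≤ C e^{(R+T)‖z‖}`. [folklore] -/
theorem norm_le_exp_of_aniso {ρ : ℂ → ℂ} {C R T : ℝ} (hT : 0 ≤ T)
    (hC : ∀ z, ‖ρ z‖ ≤ C * Real.exp (R * ‖z‖ + T * |z.im|)) (z : ℂ) :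
    ‖ρ z‖ ≤ C * Real.exp ((R + T) * ‖z‖) := by
  have hC0 : 0 ≤ C := by
    have h := (norm_nonneg _).trans (hC 0)
    simpa using h
  refine (hC z).trans (mul_le_mul_of_nonneg_left (Real.exp_le_exp.2 ?_) hC0)
  have := abs_im_le_norm z
  nlinarith

/-- The constant of an anisotropic bound is nonnegative. [folklore] -/
theorem nonneg_of_norm_le_exp_aniso {ρ : ℂ → ℂ} {C R T : ℝ}
    (hC : ∀ z, ‖ρ z‖ ≤ C * Real.exp (R * ‖z‖ + T * |z.im|)) : 0 ≤ C := by
  have h := (norm_nonneg _).trans (hC 0)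
  simpa using h

/-- **Decay along the imaginary axis (anisotropic type).** An entire `ρ` with
`‖ρ(z)‖ ≤ C e^{R‖z‖ + T|Im z|}` (`R, T ≥ 0`) and `‖ρ(x)‖ ≤ C' e^{-ax}` for `x ≥ 0` with `a > R`
satisfies `‖ρ(±iy)‖ ≤ max C C' · e^{-Vy}` (`y ≥ 0`) for every `V ≥ 0`: Phragmén–Lindelöf in the
sector `0 ≤ arg z ≤ π − θ₀` (resp. `θ₀ − π ≤ arg z ≤ 0`) for `ρ(z) e^{(a ∓ iV) z}`, the angle
`θ₀` chosen with `a cos θ₀ − (V + T) sin θ₀ ≥ R`. [cite: Boas1954, §5.4] -/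
theorem norm_le_exp_neg_of_decay_aniso {ρ : ℂ → ℂ} (hρ : Differentiable ℂ ρ) {C R T : ℝ}
    (hR0 : 0 ≤ R) (hT : 0 ≤ T) (hC : ∀ z, ‖ρ z‖ ≤ C * Real.exp (R * ‖z‖ + T * |z.im|))
    {C' a : ℝ} (ha : R < a) (hdec : ∀ x : ℝ, 0 ≤ x → ‖ρ x‖ ≤ C' * Real.exp (-(a * x)))
    {V : ℝ} (hV : 0 ≤ V) {y : ℝ} (hy : 0 ≤ y) :
    ‖ρ (y * I)‖ ≤ max C C' * Real.exp (-(V * y)) ∧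
      ‖ρ (-(y * I))‖ ≤ max C C' * Real.exp (-(V * y)) := by
  obtain ⟨θ₀, hθ0, hθhalf, hIN⟩ := exists_angle_of_lt hR0 ha (add_nonneg hV hT)
  have hC0 : 0 ≤ C := nonneg_of_norm_le_exp_aniso hC
  have hCiso := norm_le_exp_of_aniso hT hC
  have hpi := Real.two_le_pi
  have hsinθ₀ : 0 ≤ Real.sin θ₀ := (Real.sin_pos_of_pos_of_lt_pi hθ0 (by linarith)).le
  set α : ℝ := Real.pi - θ₀ with hα
  have hα0 : 0 < α := by rw [hα]; linarith
  have hαπ : α < Real.pi := by rw [hα]; linarith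
  have hcosα : Real.cos α = -Real.cos θ₀ := by rw [hα, Real.cos_pi_sub]
  have hsinα : Real.sin α = Real.sin θ₀ := by rw [hα, Real.sin_pi_sub]
  -- norms, real and imaginary parts on rays
  have hnorm_ray : ∀ (r β : ℝ), 0 ≤ r → ‖(r : ℂ) * cexp (β * I)‖ = r := fun r β hr ↦ by
    rw [norm_mul, Complex.norm_exp_ofReal_mul_I, mul_one, Complex.norm_real,
      Real.norm_of_nonneg hr]
  have him_ray' : ∀ (r β : ℝ), ((r : ℂ) * cexp (β * I)).im = r * Real.sin β := by
    intro r β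
    rw [Complex.exp_mul_I, ← Complex.ofReal_cos, ← Complex.ofReal_sin]
    simp only [mul_im, add_re, add_im, ofReal_re, ofReal_im, I_re, I_im, mul_re]
    ring
  have hre_ray : ∀ (w : ℂ) (r β : ℝ),
      (w * (r * cexp (β * I))).re = r * (w.re * Real.cos β - w.im * Real.sin β) := by
    intro w r β
    rw [Complex.exp_mul_I, ← Complex.ofReal_cos, ← Complex.ofReal_sin]
    simp only [mul_re, mul_im, add_re, add_im, ofReal_re, ofReal_im, I_re, I_im]
    ring
  -- `F_w = ρ · e^{wz}` is entire of exponential type and `‖F_w z‖ = ‖ρ z‖ e^{Re(wz)}`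
  have hFd : ∀ w : ℂ, Differentiable ℂ (fun z ↦ ρ z * cexp (w * z)) := fun w ↦
    hρ.mul (differentiable_id.const_mul w).cexp
  have hFn : ∀ w z : ℂ, ‖ρ z * cexp (w * z)‖ = ‖ρ z‖ * Real.exp ((w * z).re) := fun w z ↦ by
    rw [norm_mul, Complex.norm_exp]
  have hFb : ∀ w z : ℂ, ‖ρ z * cexp (w * z)‖ ≤ C * Real.exp ((R + T + ‖w‖) * ‖z‖) := by
    intro w z
    rw [hFn]
    have h1 : (w * z).re ≤ ‖w‖ * ‖z‖ := (re_le_norm _).trans (norm_mul_le _ _)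
    calc ‖ρ z‖ * Real.exp ((w * z).re) ≤ C * Real.exp ((R + T) * ‖z‖) * Real.exp (‖w‖ * ‖z‖) :=
          mul_le_mul (hCiso z) (Real.exp_le_exp.2 h1) (Real.exp_pos _).le (by positivity)
      _ = C * Real.exp ((R + T + ‖w‖) * ‖z‖) := by rw [mul_assoc, ← Real.exp_add]; ring_nf
  -- on the ray `arg z = 0`: `‖F_w (r)‖ ≤ C'` when `Re w = a`
  have hray0 : ∀ w : ℂ, w.re = a → ∀ r : ℝ, 0 ≤ r → ‖ρ r * cexp (w * r)‖ ≤ max C C' := by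
    intro w hw r hr
    rw [hFn, mul_re, ofReal_re, ofReal_im, mul_zero, sub_zero, hw]
    calc ‖ρ r‖ * Real.exp (a * r) ≤ C' * Real.exp (-(a * r)) * Real.exp (a * r) :=
          mul_le_mul_of_nonneg_right (hdec r hr) (Real.exp_pos _).le
      _ = C' := by rw [mul_assoc, ← Real.exp_add, neg_add_cancel, Real.exp_zero, mul_one]
      _ ≤ max C C' := le_max_right _ _
  -- on a ray `arg z = β` with `R + T|sin β| + Re(w e^{iβ}) ≤ 0`: `‖F_w‖ ≤ C`
  have hray1 : ∀ (w : ℂ) (β : ℝ),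
      R + T * |Real.sin β| + (w.re * Real.cos β - w.im * Real.sin β) ≤ 0 →
      ∀ r : ℝ, 0 ≤ r → ‖ρ (r * cexp (β * I)) * cexp (w * (r * cexp (β * I)))‖ ≤ max C C' := by
    intro w β hβ r hr
    rw [hFn, hre_ray]
    have hρr : ‖ρ (r * cexp (β * I))‖ ≤ C * Real.exp (r * (R + T * |Real.sin β|)) := by
      have h := hC (r * cexp (β * I))
      rw [hnorm_ray r β hr, him_ray', abs_mul, abs_of_nonneg hr] at h
      convert h using 2; ring
    calc ‖ρ (r * cexp (β * I))‖ * Real.exp (r * (w.re * Real.cos β - w.im * Real.sin β))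
        ≤ C * Real.exp (r * (R + T * |Real.sin β|)) *
            Real.exp (r * (w.re * Real.cos β - w.im * Real.sin β)) :=
          mul_le_mul_of_nonneg_right hρr (Real.exp_pos _).le
      _ = C * Real.exp (r * (R + T * |Real.sin β| + (w.re * Real.cos β - w.im * Real.sin β))) := by
          rw [mul_assoc, ← Real.exp_add]; ring_nf
      _ ≤ C * 1 := by
          refine mul_le_mul_of_nonneg_left ?_ hC0
          rw [Real.exp_le_one_iff]
          exact mul_nonpos_of_nonneg_of_nonpos hr hβ
      _ ≤ max C C' := by rw [mul_one]; exact le_max_left _ _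
  constructor
  · -- upper half-plane: `w = a - iV`, sector `0 ≤ arg ≤ α`, evaluated at `arg = π/2`
    set w : ℂ := (a : ℂ) - V * I with hw
    have hw_re : w.re = a := by simp [hw]
    have hw_im : w.im = -V := by simp [hw]
    have hcond : R + T * |Real.sin α| + (w.re * Real.cos α - w.im * Real.sin α) ≤ 0 := by
      rw [hw_re, hw_im, hcosα, hsinα, abs_of_nonneg hsinθ₀]; linarith
    have key := PhragmenLindelof.sector_of_norm_le_exp (hFd w) (hFb w) (θ₁ := 0) hα0 hαπ
      (C := max C C') (fun r hr ↦ by simpa using hray0 w hw_re r hr)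
      (fun r hr ↦ by simpa using hray1 w α hcond r hr) hy (θ := Real.pi / 2)
      (by positivity) (by rw [hα]; linarith)
    have hI : (y : ℂ) * cexp ((Real.pi / 2 : ℝ) * I) = y * I := by
      rw [Complex.exp_mul_I, ← Complex.ofReal_cos, ← Complex.ofReal_sin, Real.cos_pi_div_two,
        Real.sin_pi_div_two]
      simp
    rw [hI, hFn] at key
    have hre : (w * (y * I)).re = V * y := by
      rw [mul_re, hw_re, hw_im, mul_I_re, mul_I_im, ofReal_re, ofReal_im]; ring
    rw [hre] at key
    calc ‖ρ (y * I)‖ = ‖ρ (y * I)‖ * Real.exp (V * y) * Real.exp (-(V * y)) := by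
          rw [mul_assoc, ← Real.exp_add, add_neg_cancel, Real.exp_zero, mul_one]
      _ ≤ max C C' * Real.exp (-(V * y)) :=
          mul_le_mul_of_nonneg_right key (Real.exp_pos _).le
  · -- lower half-plane: `w = a + iV`, sector `θ₀ - π ≤ arg ≤ 0`, evaluated at `arg = -π/2`
    set w : ℂ := (a : ℂ) + V * I with hw
    have hw_re : w.re = a := by simp [hw]
    have hw_im : w.im = V := by simp [hw]
    have hcond : R + T * |Real.sin (θ₀ - Real.pi)| +
        (w.re * Real.cos (θ₀ - Real.pi) - w.im * Real.sin (θ₀ - Real.pi)) ≤ 0 := by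
      rw [hw_re, hw_im, Real.cos_sub_pi, Real.sin_sub_pi, abs_neg, abs_of_nonneg hsinθ₀]
      linarith
    have hsum : ((θ₀ - Real.pi : ℝ) : ℂ) + (α : ℂ) = 0 := by
      rw [hα]; push_cast; ring
    have key := PhragmenLindelof.sector_of_norm_le_exp (hFd w) (hFb w) (θ₁ := θ₀ - Real.pi)
      hα0 hαπ (C := max C C') (fun r hr ↦ hray1 w _ hcond r hr)
      (fun r hr ↦ by rw [hsum]; simpa using hray0 w hw_re r hr) hy (θ := -(Real.pi / 2))
      (by linarith) (by rw [hα]; linarith)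
    have hI : (y : ℂ) * cexp ((-(Real.pi / 2) : ℝ) * I) = -(y * I) := by
      rw [Complex.exp_mul_I, ← Complex.ofReal_cos, ← Complex.ofReal_sin, Real.cos_neg,
        Real.sin_neg, Real.cos_pi_div_two, Real.sin_pi_div_two]
      simp
    rw [hI, hFn] at key
    have hre : (w * -(y * I)).re = V * y := by
      rw [mul_re, hw_re, hw_im, neg_re, neg_im, mul_I_re, mul_I_im, ofReal_re, ofReal_im]; ring
    rw [hre] at key
    calc ‖ρ (-(y * I))‖ = ‖ρ (-(y * I))‖ * Real.exp (V * y) * Real.exp (-(V * y)) := by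
          rw [mul_assoc, ← Real.exp_add, add_neg_cancel, Real.exp_zero, mul_one]
      _ ≤ max C C' * Real.exp (-(V * y)) :=
          mul_le_mul_of_nonneg_right key (Real.exp_pos _).le

/-- **The indicator inequality for anisotropic exponential type.** An entire function `ρ` with
`‖ρ(z)‖ ≤ C e^{R‖z‖ + T|Im z|}` (`R, T ≥ 0`) which decays on the positive real axis like
`‖ρ(x)‖ ≤ C' e^{-ax}` with `a > R` vanishes identically. (For `ρ(x) = ∫ e^{-sx} dμ(s)` with
`supp μ` in a tall rectangle of half-width `R` centred on the imaginary axis this is Steuding's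
Lemma 5.8 "if `f ≢ 0` then `limsup_{r→∞} log|f(r)|/r > σ₀`" for supports in a half-plane.)
Proof: `norm_le_exp_neg_of_decay_aniso` and the quadrant principle (with the isotropic majorant
`e^{(R+T)‖z‖}` as Phragmén–Lindelöf growth condition, and the bound `‖ρ(−x)‖ ≤ C e^{Rx}` on the
negative real axis) give super-exponential decay of `z ↦ ρ((1+i)z)` on `ℝ₊` and boundedness on
`iℝ`; conclude by Mathlib's `eq_zero_on_right_half_plane_of_superexponential_decay` and the
identity theorem. [cite: Steuding2007, Lemma 5.8] [cite: Boas1954, §5.4] -/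
theorem eq_zero_of_norm_le_exp_of_decay_aniso {ρ : ℂ → ℂ} (hρ : Differentiable ℂ ρ) {C R T : ℝ}
    (hR0 : 0 ≤ R) (hT : 0 ≤ T) (hC : ∀ z, ‖ρ z‖ ≤ C * Real.exp (R * ‖z‖ + T * |z.im|))
    {C' a : ℝ} (ha : R < a) (hdec : ∀ x : ℝ, 0 ≤ x → ‖ρ x‖ ≤ C' * Real.exp (-(a * x))) (z : ℂ) :
    ρ z = 0 := by
  have ha0 : 0 < a := hR0.trans_lt ha
  have hC0 : 0 ≤ C := nonneg_of_norm_le_exp_aniso hC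
  have hCiso := norm_le_exp_of_aniso hT hC
  set K : ℝ := max C C' with hK
  have hK0 : 0 ≤ K := hC0.trans (le_max_left _ _)
  have himag := fun (V : ℝ) (hV : 0 ≤ V) (y : ℝ) (hy : 0 ≤ y) ↦
    norm_le_exp_neg_of_decay_aniso hρ hR0 hT hC ha hdec hV hy
  have hre' : ∀ x : ℝ, 0 ≤ x → ‖ρ x‖ ≤ C' * Real.exp (-a * x) := fun x hx ↦ by
    rw [neg_mul]; exact hdec x hx
  -- quadrant bounds
  have hQ1 : ∀ V : ℝ, 0 ≤ V → ∀ z : ℂ, 0 ≤ z.re → 0 ≤ z.im →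
      ‖ρ z‖ ≤ max C' K * Real.exp (-a * z.re + -V * z.im) := fun V hV z h1 h2 ↦
    norm_le_exp_quadrant_I hρ hCiso hre' (fun y hy ↦ by rw [neg_mul]; exact (himag V hV y hy).1)
      h1 h2
  have hQ4 : ∀ V : ℝ, 0 ≤ V → ∀ z : ℂ, 0 ≤ z.re → z.im ≤ 0 →
      ‖ρ z‖ ≤ max K C' * Real.exp (-V * (-z.im) + -a * z.re) := fun V hV z h1 h2 ↦
    norm_le_exp_quadrant_IV hρ hCiso hre' (fun y hy ↦ by rw [neg_mul]; exact (himag V hV y hy).2)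
      h1 h2
  have hQ2 : ∀ z : ℂ, z.re ≤ 0 → 0 ≤ z.im →
      ‖ρ z‖ ≤ max K C * Real.exp (-R * z.im + R * (-z.re)) := fun z h1 h2 ↦
    norm_le_exp_quadrant_II hρ hCiso (C₁ := C) (s := R)
      (fun x hx ↦ by
        have h := hC (-x)
        simpa [abs_of_nonneg hx] using h)
      (fun y hy ↦ by rw [neg_mul]; exact (himag R hR0 y hy).1) h1 h2
  -- the rotated function `f(w) = ρ((1+i)w)`
  have h11 : (1 + I : ℂ) ≠ 0 := by
    intro h; have := congrArg Complex.re h; simp at this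
  set f : ℂ → ℂ := fun w ↦ ρ ((1 + I) * w) with hf
  have hfd : Differentiable ℂ f := hρ.comp (differentiable_id.const_mul _)
  have hfb : ∀ w, ‖f w‖ ≤ C * Real.exp (((R + T) * ‖(1 : ℂ) + I‖) * ‖w‖) := fun w ↦ by
    simp only [hf]
    calc ‖ρ ((1 + I) * w)‖ ≤ C * Real.exp ((R + T) * ‖(1 + I) * w‖) := hCiso _
      _ = C * Real.exp (((R + T) * ‖(1 : ℂ) + I‖) * ‖w‖) := by rw [norm_mul, mul_assoc]
  have hre1 : ∀ x : ℝ, ((1 + I) * (x : ℂ)).re = x := fun x ↦ by simp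
  have him1 : ∀ x : ℝ, ((1 + I) * (x : ℂ)).im = x := fun x ↦ by simp
  have hre2 : ∀ y : ℝ, ((1 + I) * ((y : ℂ) * I)).re = -y := fun y ↦ by
    simp [mul_re]
  have him2 : ∀ y : ℝ, ((1 + I) * ((y : ℂ) * I)).im = y := fun y ↦ by
    simp [mul_im]
  have hzero : EqOn f 0 {w : ℂ | 0 ≤ w.re} := by
    refine PhragmenLindelof.eq_zero_on_right_half_plane_of_superexponential_decay
      hfd.diffContOnCl (isBigO_exp_of_norm_le_exp hfb _) (fun n ↦ ?_)
      ⟨max (max K C) (max K C'), fun y ↦ ?_⟩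
    · -- super-exponential decay on `ℝ₊` (rate `V = n + 1`)
      have hV : (0 : ℝ) ≤ n + 1 := by positivity
      have hbound : ∀ x : ℝ, 0 ≤ x → Real.exp x ^ n * ‖f x‖ ≤ max C' K * Real.exp (-x) := by
        intro x hx
        have h := hQ1 (n + 1) hV ((1 + I) * x) (by rw [hre1]; exact hx) (by rw [him1]; exact hx)
        rw [hre1, him1] at h
        simp only [hf]
        calc Real.exp x ^ n * ‖ρ ((1 + I) * x)‖
            ≤ Real.exp x ^ n * (max C' K * Real.exp (-a * x + -(n + 1) * x)) :=
              mul_le_mul_of_nonneg_left h (by positivity)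
          _ = max C' K * Real.exp (-x - a * x) := by
              rw [← Real.exp_nat_mul, mul_left_comm, ← Real.exp_add]
              congr 1; ring_nf
          _ ≤ max C' K * Real.exp (-x) := by
              refine mul_le_mul_of_nonneg_left (Real.exp_le_exp.2 ?_) (le_max_of_le_right hK0)
              nlinarith
      refine tendsto_of_tendsto_of_tendsto_of_le_of_le' tendsto_const_nhds ?_
        (Eventually.of_forall fun x ↦ by positivity) ((eventually_ge_atTop 0).mono hbound)
      have h := (tendsto_const_nhds (x := max C' K)).mul Real.tendsto_exp_neg_atTop_nhds_zero
      rwa [mul_zero] at h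
    · -- boundedness on `iℝ`
      simp only [hf]
      rcases le_total 0 y with hy | hy
      · have h := hQ2 ((1 + I) * (y * I)) (by rw [hre2]; linarith) (by rw [him2]; exact hy)
        rw [hre2, him2, neg_neg] at h
        calc ‖ρ ((1 + I) * (y * I))‖ ≤ max K C * Real.exp (-R * y + R * y) := h
          _ = max K C := by rw [neg_mul, neg_add_cancel, Real.exp_zero, mul_one]
          _ ≤ _ := le_max_left _ _
      · have h := hQ4 0 le_rfl ((1 + I) * (y * I)) (by rw [hre2]; linarith)
          (by rw [him2]; exact hy)
        rw [hre2, him2] at h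
        calc ‖ρ ((1 + I) * (y * I))‖ ≤ max K C' * Real.exp (-0 * -y + -a * -y) := h
          _ ≤ max K C' * 1 := by
              refine mul_le_mul_of_nonneg_left ?_ (le_max_of_le_left hK0)
              rw [Real.exp_le_one_iff]; nlinarith
          _ ≤ _ := by rw [mul_one]; exact le_max_right _ _
  -- identity theorem: `ρ = 0` near `1 + i`, hence everywhere
  have hρan : AnalyticOnNhd ℂ ρ univ := fun w _ ↦ hρ.analyticAt w
  have hev : ρ =ᶠ[𝓝 (1 + I)] 0 := by
    have hopen : IsOpen {w : ℂ | 0 < (w / (1 + I)).re} :=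
      isOpen_lt continuous_const (Complex.continuous_re.comp (continuous_id.div_const _))
    have hmem : (1 + I : ℂ) ∈ {w : ℂ | 0 < (w / (1 + I)).re} := by
      show 0 < ((1 + I) / (1 + I) : ℂ).re
      rw [div_self h11]; simp
    filter_upwards [hopen.mem_nhds hmem] with w hw
    have hw' : ρ w = f (w / (1 + I)) := by
      simp only [hf]; congr 1; field_simp
    rw [hw']
    exact hzero (le_of_lt hw)
  exact hρan.eqOn_zero_of_preconnected_of_eventuallyEq_zero isPreconnected_univ (mem_univ _) hev
    (mem_univ z)

end Literature.Analysis.Complex
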